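import Mathlib
import HarnessLib
import Summits.KontsevichZagierPeriods.Zeta5Search.DougallTerminatingGamma
import Literature.Analysis.SpecialFunctions.LemniscaticEllipticValuesProofs

/-!
# ζ(5) search — polynomial growth of the Gamma side of Dougall's Carlson function (cell `pub-zeta5`, ct-1 g26)

HONEST FRAMING: systematic search; no irrationality claim unless kernel-certified.  Elementary bounds for quotients of
Gamma values through Euler's Beta integral; nothing here is an irrationality result; no named fact is discharged.

Brick B5d of `HOME/ct-1/g26/VWP-BLUEPRINT.md` (§3 B5, refined): Carlson's theorem (bounded form,
`Literature.Analysis.Complex.CarlsonTheorem`) is applied to `f(z)/(1+z)^N`, so the Gamma side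
`G(z) = Γ(h₁)Γ(h₂)·Γ(1+h₀+z)Γ(1+h₀−h₁−h₂+z)/(Γ(1+h₀−h₁−h₂)Γ(1+h₀−h₁+z)Γ(1+h₀−h₂+z))` must grow at most polynomially on
`{Re z ≥ 0}`.  For REAL `h₀, h₁, h₂` with `h₁, h₂ > 0`, `h₁ + h₂ < 1 + h₀` this file proves
`‖Γ(1+h₀+z)Γ(1+h₀−h₁−h₂+z)/(Γ(1+h₀−h₁+z)Γ(1+h₀−h₂+z))‖ ≤ C·(1+‖z‖)^{⌊h₂⌋₊+1}` on `{Re z ≥ 0}`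
(`gamma_side_polynomial_bound`), from:
* `norm_betaIntegral_le` — `‖B(u,v)‖ ≤ ∫₀¹ t^{a−1}(1−t)^{Re v−1} dt` for `0 < a ≤ Re u`, `0 < Re v` (the real Beta
  integrand's integrability is the tree's `Literature.Analysis.SpecialFunctions.integrableOn_Ioo_rpow_mul_one_sub_rpow`);
* `norm_Gamma_div_Gamma_add_le` — `‖Γ(s)/Γ(s+b)‖ ≤ (∫₀¹ t^{a−1}(1−t)^{b−1} dt)/Γ(b)` for real `b > 0`, `0 < a ≤ Re s`
  (the DECAYING ratio, bounded by a constant);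
* `norm_Gamma_add_div_Gamma_le` — `‖Γ(s+θ)/Γ(s)‖ ≤ ‖s‖·(∫₀¹ t^{a+θ−1}(1−t)^{−θ} dt)/Γ(1−θ)` for `0 ≤ θ < 1`, `0 < a ≤ Re s`
  (the fractional part of the GROWING ratio; its integer part is the block `(s+θ)_n`, `norm_rf_le`).
Theorems only (no new definitions).
-/

noncomputable section

namespace Summit.KontsevichZagierPeriods.Zeta5Search.DougallGammaSideBound

open MeasureTheory Set Filter
open Summit.KontsevichZagierPeriods.Zeta5Search.HypergeometricWhipple (rf rf_zero rf_succ)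
open Summit.KontsevichZagierPeriods.Zeta5Search.DougallTerminatingGamma (Gamma_add_nat_eq_mul_rf)

/-! ### 1. The Beta integral is dominated by a real Beta integrand -/

/-- Norm of the Beta integrand on `(0,1)`. -/
theorem norm_betaIntegrand {t : ℝ} (ht : t ∈ Ioo (0 : ℝ) 1) (u v : ℂ) :
    ‖(t : ℂ) ^ (u - 1) * (1 - (t : ℂ)) ^ (v - 1)‖ = t ^ (u.re - 1) * (1 - t) ^ (v.re - 1) := by
  have h1 : 0 < 1 - t := by linarith [ht.2]
  rw [norm_mul, Complex.norm_cpow_eq_rpow_re_of_pos ht.1,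
    show (1 : ℂ) - (t : ℂ) = ((1 - t : ℝ) : ℂ) by push_cast; ring, Complex.norm_cpow_eq_rpow_re_of_pos h1]
  simp

/-- **`‖B(u,v)‖ ≤ ∫₀¹ t^{a−1}(1−t)^{Re v−1} dt`** for `0 < a ≤ Re u` and `0 < Re v` (on `(0,1)` the modulus of the
integrand is `t^{Re u−1}(1−t)^{Re v−1} ≤ t^{a−1}(1−t)^{Re v−1}`). -/
theorem norm_betaIntegral_le {u v : ℂ} {a : ℝ} (ha : 0 < a) (hau : a ≤ u.re) (hv : 0 < v.re) :
    ‖Complex.betaIntegral u v‖ ≤ ∫ t in Ioo (0 : ℝ) 1, t ^ (a - 1) * (1 - t) ^ (v.re - 1) := by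
  have hu : 0 < u.re := lt_of_lt_of_le ha hau
  have hconv := Complex.betaIntegral_convergent hu hv
  unfold Complex.betaIntegral
  calc ‖∫ x in (0 : ℝ)..1, (x : ℂ) ^ (u - 1) * (1 - (x : ℂ)) ^ (v - 1)‖
      ≤ ∫ x in Set.uIoc (0 : ℝ) 1, ‖(x : ℂ) ^ (u - 1) * (1 - (x : ℂ)) ^ (v - 1)‖ :=
        intervalIntegral.norm_integral_le_integral_norm_uIoc
    _ = ∫ x in Ioo (0 : ℝ) 1, ‖(x : ℂ) ^ (u - 1) * (1 - (x : ℂ)) ^ (v - 1)‖ := by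
        rw [uIoc_of_le zero_le_one, integral_Ioc_eq_integral_Ioo]
    _ ≤ ∫ t in Ioo (0 : ℝ) 1, t ^ (a - 1) * (1 - t) ^ (v.re - 1) := by
        refine setIntegral_mono_on ((hconv.norm).1.mono_set Ioo_subset_Ioc_self)
          (Literature.Analysis.SpecialFunctions.integrableOn_Ioo_rpow_mul_one_sub_rpow ha hv) measurableSet_Ioo
          fun t ht => ?_
        rw [norm_betaIntegrand ht]
        have h1 : 0 ≤ (1 - t) ^ (v.re - 1) := Real.rpow_nonneg (by linarith [ht.2]) _
        exact mul_le_mul_of_nonneg_right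
          (Real.rpow_le_rpow_of_exponent_ge ht.1 ht.2.le (by linarith)) h1

/-! ### 2. Two Gamma quotients through the Beta integral -/

/-- **The decaying ratio is bounded**: for real `b > 0` and `0 < a ≤ Re s`,
`‖Γ(s)/Γ(s+b)‖ ≤ (∫₀¹ t^{a−1}(1−t)^{b−1} dt)/Γ(b)` (from `Γ(s)Γ(b) = Γ(s+b)B(s,b)`). -/
theorem norm_Gamma_div_Gamma_add_le {s : ℂ} {a b : ℝ} (ha : 0 < a) (has : a ≤ s.re) (hb : 0 < b) :
    ‖Complex.Gamma s / Complex.Gamma (s + b)‖ ≤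
      (∫ t in Ioo (0 : ℝ) 1, t ^ (a - 1) * (1 - t) ^ (b - 1)) / Real.Gamma b := by
  have hs : 0 < s.re := lt_of_lt_of_le ha has
  have hbc : 0 < ((b : ℂ)).re := by simpa using hb
  have key := Complex.Gamma_mul_Gamma_eq_betaIntegral hs hbc
  have hΓsb : Complex.Gamma (s + b) ≠ 0 := Complex.Gamma_ne_zero_of_re_pos (by simp; linarith)
  have hΓb : Complex.Gamma (b : ℂ) ≠ 0 := Complex.Gamma_ne_zero_of_re_pos hbc
  have hΓbR : 0 < Real.Gamma b := Real.Gamma_pos_of_pos hb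
  have e : Complex.Gamma s / Complex.Gamma (s + b) = Complex.betaIntegral s b / Complex.Gamma (b : ℂ) := by
    field_simp
    linear_combination key
  rw [e, norm_div, Complex.Gamma_ofReal, Complex.norm_real, Real.norm_of_nonneg hΓbR.le]
  exact div_le_div_of_nonneg_right (by simpa using norm_betaIntegral_le (v := (b : ℂ)) ha has hbc) hΓbR.le

/-- **The fractional part of the growing ratio**: for `0 ≤ θ < 1` and `0 < a ≤ Re s`,
`‖Γ(s+θ)/Γ(s)‖ ≤ ‖s‖·(∫₀¹ t^{a+θ−1}(1−t)^{−θ} dt)/Γ(1−θ)` (from `Γ(s+θ)Γ(1−θ) = Γ(s+1)B(s+θ,1−θ)`, `Γ(s+1) = sΓ(s)`). -/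
theorem norm_Gamma_add_div_Gamma_le {s : ℂ} {a θ : ℝ} (ha : 0 < a) (has : a ≤ s.re) (hθ0 : 0 ≤ θ) (hθ1 : θ < 1) :
    ‖Complex.Gamma (s + θ) / Complex.Gamma s‖ ≤
      ‖s‖ * ((∫ t in Ioo (0 : ℝ) 1, t ^ (a + θ - 1) * (1 - t) ^ ((1 - θ) - 1)) / Real.Gamma (1 - θ)) := by
  have hs : 0 < s.re := lt_of_lt_of_le ha has
  have hsθ : 0 < (s + θ).re := by simp; linarith
  have h1θ : 0 < (((1 - θ : ℝ)) : ℂ).re := by simp; linarith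
  have key := Complex.Gamma_mul_Gamma_eq_betaIntegral hsθ h1θ
  rw [show s + (θ : ℂ) + ((1 - θ : ℝ) : ℂ) = s + 1 by push_cast; ring,
    Complex.Gamma_add_one _ (by intro h; rw [h] at hs; simp at hs)] at key
  have hΓs : Complex.Gamma s ≠ 0 := Complex.Gamma_ne_zero_of_re_pos hs
  have hΓ1 : Complex.Gamma (((1 - θ : ℝ)) : ℂ) ≠ 0 := Complex.Gamma_ne_zero_of_re_pos h1θ
  have hΓ1R : 0 < Real.Gamma (1 - θ) := Real.Gamma_pos_of_pos (by linarith)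
  have e : Complex.Gamma (s + θ) / Complex.Gamma s =
      s * (Complex.betaIntegral (s + θ) ((1 - θ : ℝ)) / Complex.Gamma (((1 - θ : ℝ)) : ℂ)) := by
    field_simp
    linear_combination key
  rw [e, norm_mul, norm_div, Complex.Gamma_ofReal, Complex.norm_real, Real.norm_of_nonneg hΓ1R.le]
  refine mul_le_mul_of_nonneg_left ?_ (norm_nonneg _)
  refine div_le_div_of_nonneg_right ?_ hΓ1R.le
  have h := norm_betaIntegral_le (u := s + θ) (v := ((1 - θ : ℝ) : ℂ)) (a := a + θ) (by linarith)
    (by simp; linarith) h1θ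
  simpa using h

/-- The block `(w)_n` grows at most like `(‖w‖+n)^n`. -/
theorem norm_rf_le (w : ℂ) (n : ℕ) : ‖rf w n‖ ≤ (‖w‖ + n) ^ n := by
  induction n with
  | zero => simp [rf_zero]
  | succ n ih =>
    rw [rf_succ, norm_mul, pow_succ, Nat.cast_succ]
    have h1 : ‖w + (n : ℂ)‖ ≤ ‖w‖ + (n + 1) := by
      calc ‖w + (n : ℂ)‖ ≤ ‖w‖ + ‖(n : ℂ)‖ := norm_add_le _ _
        _ = ‖w‖ + n := by rw [Complex.norm_natCast]
        _ ≤ ‖w‖ + (n + 1) := by linarith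
    have h2 : (‖w‖ + n) ^ n ≤ (‖w‖ + (n + 1)) ^ n := by
      gcongr; linarith
    calc ‖rf w n‖ * ‖w + (n : ℂ)‖ ≤ (‖w‖ + n) ^ n * (‖w‖ + (n + 1)) :=
          mul_le_mul ih h1 (norm_nonneg _) (by positivity)
      _ ≤ (‖w‖ + (n + 1)) ^ n * (‖w‖ + (n + 1)) := by gcongr

/-! ### 3. The Gamma side grows at most polynomially on the closed right half-plane -/

/-- Nonnegativity of the real Beta integrals used as constants. -/
theorem real_betaIntegral_nonneg (a b : ℝ) : 0 ≤ ∫ t in Ioo (0 : ℝ) 1, t ^ (a - 1) * (1 - t) ^ (b - 1) :=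
  setIntegral_nonneg measurableSet_Ioo fun t ht =>
    mul_nonneg (Real.rpow_nonneg ht.1.le _) (Real.rpow_nonneg (by linarith [ht.2]) _)

/-- **B5d — polynomial bound for the Gamma side.**  For real `h₁, h₂ > 0` with `h₁ + h₂ < 1 + h₀` there is `C` with
`‖Γ(1+h₀+z)Γ(1+h₀−h₁−h₂+z)/(Γ(1+h₀−h₁+z)Γ(1+h₀−h₂+z))‖ ≤ C·(1+‖z‖)^{⌊h₂⌋₊+1}` for every `z` with `Re z ≥ 0`
(write `h₂ = n + θ`: the growing ratio `Γ(q+h₂+z)/Γ(q+z)`, `q = 1+h₀−h₂`, is the block `(q+θ+z)_n` times the fractional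
ratio of `norm_Gamma_add_div_Gamma_le`; the decaying ratio `Γ(p+z)/Γ(p+h₂+z)`, `p = 1+h₀−h₁−h₂`, is bounded by
`norm_Gamma_div_Gamma_add_le`). -/
theorem gamma_side_polynomial_bound (h₀ h₁ h₂ : ℝ) (hh₁ : 0 < h₁) (hh₂ : 0 < h₂) (hsum : h₁ + h₂ < 1 + h₀) :
    ∃ C : ℝ, ∀ z : ℂ, 0 ≤ z.re →
      ‖Complex.Gamma (1 + h₀ + z) * Complex.Gamma (1 + h₀ - h₁ - h₂ + z) /
          (Complex.Gamma (1 + h₀ - h₁ + z) * Complex.Gamma (1 + h₀ - h₂ + z))‖ ≤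
        C * (1 + ‖z‖) ^ (⌊h₂⌋₊ + 1) := by
  set n : ℕ := ⌊h₂⌋₊ with hn
  set θ : ℝ := h₂ - n with hθ
  have hθ0 : 0 ≤ θ := by rw [hθ]; linarith [Nat.floor_le hh₂.le]
  have hθ1 : θ < 1 := by rw [hθ]; linarith [Nat.lt_floor_add_one h₂]
  set q : ℝ := 1 + h₀ - h₂ with hq
  set p : ℝ := 1 + h₀ - h₁ - h₂ with hp
  have hq0 : 0 < q := by rw [hq]; linarith
  have hp0 : 0 < p := by rw [hp]; linarith
  set K₂ : ℝ := (∫ t in Ioo (0 : ℝ) 1, t ^ (p - 1) * (1 - t) ^ (h₂ - 1)) / Real.Gamma h₂ with hK₂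
  set K₃ : ℝ := (∫ t in Ioo (0 : ℝ) 1, t ^ (q + θ - 1) * (1 - t) ^ ((1 - θ) - 1)) / Real.Gamma (1 - θ) with hK₃
  have hK₂0 : 0 ≤ K₂ := div_nonneg (real_betaIntegral_nonneg _ _) (Real.Gamma_pos_of_pos hh₂).le
  have hK₃0 : 0 ≤ K₃ := div_nonneg (real_betaIntegral_nonneg _ _) (Real.Gamma_pos_of_pos (by linarith)).le
  refine ⟨(q + h₂ + 1) ^ n * ((q + 1) * K₃) * K₂, fun z hz => ?_⟩
  -- the two shifted variables
  set s₁ : ℂ := (q : ℂ) + z with hs₁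
  set s₂ : ℂ := (p : ℂ) + z with hs₂
  have hs₁re : q ≤ s₁.re := by simp [hs₁]; linarith
  have hs₂re : p ≤ s₂.re := by simp [hs₂]; linarith
  have hpole : ∀ m : ℕ, s₁ + θ ≠ -(m : ℂ) := by
    intro m h
    have := congrArg Complex.re h
    simp [hs₁] at this
    linarith [m.cast_nonneg (α := ℝ)]
  -- rewrite the four Gamma arguments
  have E1 : Complex.Gamma (1 + h₀ + z) = Complex.Gamma (s₁ + θ) * rf (s₁ + θ) n := by
    rw [← Gamma_add_nat_eq_mul_rf hpole n]
    congr 1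
    rw [hs₁, hθ, hq]; push_cast; ring
  have E2 : Complex.Gamma (1 + h₀ - h₁ + z) = Complex.Gamma (s₂ + h₂) := by
    congr 1; rw [hs₂, hp]; push_cast; ring
  have E3 : Complex.Gamma (1 + h₀ - h₂ + z) = Complex.Gamma s₁ := by
    congr 1; rw [hs₁, hq]; push_cast; ring
  have E4 : Complex.Gamma (1 + h₀ - h₁ - h₂ + z) = Complex.Gamma s₂ := by
    congr 1; rw [hs₂, hp]; push_cast; ring
  rw [E1, E2, E3, E4,
    show Complex.Gamma (s₁ + θ) * rf (s₁ + θ) n * Complex.Gamma s₂ / (Complex.Gamma (s₂ + h₂) * Complex.Gamma s₁) =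
      rf (s₁ + θ) n * (Complex.Gamma (s₁ + θ) / Complex.Gamma s₁) * (Complex.Gamma s₂ / Complex.Gamma (s₂ + h₂)) by ring,
    norm_mul, norm_mul]
  -- the three bounds
  have hz1 : 0 ≤ ‖z‖ := norm_nonneg z
  have b1 : ‖rf (s₁ + θ) n‖ ≤ (q + h₂ + 1) ^ n * (1 + ‖z‖) ^ n := by
    rw [← mul_pow]
    refine (norm_rf_le _ n).trans (pow_le_pow_left₀ (by positivity) ?_ n)
    have hsθ : s₁ + θ = (((q + θ : ℝ)) : ℂ) + z := by rw [hs₁]; push_cast; ring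
    have hs : ‖s₁ + θ‖ ≤ (q + θ) + ‖z‖ := by
      calc ‖s₁ + θ‖ = ‖(((q + θ : ℝ)) : ℂ) + z‖ := by rw [hsθ]
        _ ≤ ‖(((q + θ : ℝ)) : ℂ)‖ + ‖z‖ := norm_add_le _ _
        _ = (q + θ) + ‖z‖ := by rw [Complex.norm_real, Real.norm_of_nonneg (by linarith)]
    have hnθ : (n : ℝ) + θ = h₂ := by rw [hθ]; ring
    nlinarith
  have b2 : ‖Complex.Gamma (s₁ + θ) / Complex.Gamma s₁‖ ≤ ((q + 1) * (1 + ‖z‖)) * K₃ := by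
    refine (norm_Gamma_add_div_Gamma_le hq0 hs₁re hθ0 hθ1).trans ?_
    rw [← hK₃]
    refine mul_le_mul_of_nonneg_right ?_ hK₃0
    calc ‖s₁‖ ≤ ‖(q : ℂ)‖ + ‖z‖ := norm_add_le _ _
      _ = q + ‖z‖ := by rw [Complex.norm_real, Real.norm_of_nonneg hq0.le]
      _ ≤ (q + 1) * (1 + ‖z‖) := by nlinarith
  have b3 : ‖Complex.Gamma s₂ / Complex.Gamma (s₂ + h₂)‖ ≤ K₂ := by
    rw [hK₂]; exact norm_Gamma_div_Gamma_add_le hp0 hs₂re hh₂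
  calc ‖rf (s₁ + ↑θ) n‖ * ‖Complex.Gamma (s₁ + ↑θ) / Complex.Gamma s₁‖ * ‖Complex.Gamma s₂ / Complex.Gamma (s₂ + ↑h₂)‖
      ≤ ((q + h₂ + 1) ^ n * (1 + ‖z‖) ^ n) * (((q + 1) * (1 + ‖z‖)) * K₃) * K₂ :=
        mul_le_mul (mul_le_mul b1 b2 (norm_nonneg _) (by positivity)) b3 (norm_nonneg _) (by positivity)
    _ = (q + h₂ + 1) ^ n * ((q + 1) * K₃) * K₂ * (1 + ‖z‖) ^ (n + 1) := by ring

end Summit.KontsevichZagierPeriods.Zeta5Search.DougallGammaSideBound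

end
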